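import Mathlib
import HarnessLib
import Literature.MathematicalPhysics.QuantumLattice.SectorisedEffectiveActionBoundWeightedPlateau
import Summits.HubbardSuperconductivity.HubbardSuperconductivity.Theorems.KLProgrammeKLRegimeEngineNormsStepDoor
import Summits.HubbardSuperconductivity.HubbardSuperconductivity.Theorems.KLProgrammeKLRegimeEngineE4ScaleDoor

/-!
# Route `KLProgramme` — ENGINE child stmt-HubbardSuperconductivity-20236 `KLRegimeEngineV16`, stubs (b)/(c) at the inductive scales:
# the DECAY-WEIGHTED NORMS-STEP DOOR — the sectorised single-slice step `𝒱_{k+2} = effAction g_{k+2} 𝒱_{k+1}` with the scale tree weight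
# `klScaleWt` on the leg positions, in the currency of the (E1-W) invariant `KernelNormsWt` / `klWtPinnedSum` (k3c3-p2, …EngineE4ScaleDoor)

Cell gate-hubbard-kl, seat hubbard-kl-r2d-p2 (g4); sequel of `…EngineNormsStepDoor` (unweighted door, plateau facts of the step).  k3c3-p2's (E4)ₙ door
(`engineFirstMoments_of_wtSum_fixed` / `…_of_wtPinnedSum`) and the (E1-W) thread of the engine skeleton read weighted pinned sums of the sectorised
kernels `kernel (map (toLin' E(klAnisoFamily n)) 𝒱_n)` with the tree weight `klScaleWt L M β n`; their residual (R1) is «a ONE-STEP weighted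
sectorised determinant-bounded integration at scale n».  This file is that step as a door, by the weighted plateau step
`Literature.…SectorisedEffectiveActionBoundWeightedPlateau.sum_wt_norm_sectorAnalysis_effAction_le_of_plateau`:

* **`klNormsStepWt_of_sliceConsts`** — for every fat index `k` (step `n ↦ n+1`, `n = k+1`), weight scale `nw` and output index `j ≥ k+1`: from
  `Z_{k+1} ≠ 0`, WEIGHTED input sizes `Σ_{Y_q = w} klScaleWt_{nw}(pos Y)·‖kernel (map (toLin' E(klAnisoFamily k)) 𝒱_{k+1}) (2m′) Y‖ ≤ B m′`
  (family of index `k` = the LAGGED, plateau-complete measurement of `𝒱_{k+1}`), the explicit Gram form of `S(F̃_k)ᵀ·klSliceCov (k+2)·S(F̃_k)`,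
  its WEIGHTED row/column sums `≤ α` (weight `klScaleWt_{nw}{pos X, pos Y}`), the weighted overlap constants `(cr, cc)` of
  `E(klAnisoFamily j)·S(F̃_k)`, a radius `ρ` and `θ < 1`:  `Z_{k+2} ≠ 0` and, one output leg pinned,
  `Σ_{X″_p = w″} klScaleWt_{nw}(pos X″)·‖kernel (map (toLin' E(klAnisoFamily j)) 𝒱_{k+2}) (m+1) X″‖ ≤ cr·cc^m·ρ^{-(m+1)}·e·normV/(1−θ)`;
* `klWtPinnedSum_le_of_sliceConsts` — the reading `j = nw = k+2`: `klWtPinnedSum … (k+2) (m+1) p w″ ≤ ε^m·(the same)`, i.e. the (E1-W)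
  quantity of `𝒱_{k+2}` in its own family and weight (`KernelNormsWt … (k+2)` for any budget above it).

RESIDUAL (by hypothesis · producer · lane): explicit Gram `q fv gv κ` · `gram_vectors_klSliceCov_bgmFat_klEng` (…SectorSliceGramVectorsRegime) · k3c2-p3;
WEIGHTED `α` (first moment of the slice in units `Λ_{nw}⁻¹`) and WEIGHTED overlap `cr/cc` · (R2) of k3c3-p2's table · k3c2-p3 / p4; `B` = the lagged
weighted invariant of `𝒱_{k+1}` and the fit · E1 power counting.  Everything is proved; no definitions; nothing about the model is asserted beyond these
implications.
-/

noncomputable section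

namespace Summit.HubbardSuperconductivity.HubbardSuperconductivity.Theorems.EngineV8

set_option linter.dupNamespace false -- summit = problem name (single-conjunct summit), D-0017

open Real Finset Literature.MathematicalPhysics.QuantumLattice Literature.Probability.LatticeModels GrassmannAlgebra
open Literature.Probability.LatticeModels.BattleFederbush
open Summit.HubbardSuperconductivity.HubbardSuperconductivity.Theorems.KLProgrammeLegKernels
open Summit.HubbardSuperconductivity.HubbardSuperconductivity.Theorems.KLRegimeSplit
open Summit.HubbardSuperconductivity.HubbardSuperconductivity.Theorems.KLRegimeWick
open scoped InnerProductSpace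

variable {L M : ℕ} [NeZero L] [NeZero M]

/-- **`klNormsStepWt_of_sliceConsts` — the decay-weighted norms-step door** (step `k+1 ↦ k+2`, weight `klScaleWt L M β nw` on the leg positions
`latticeLegPos (4M)`, output family `klAnisoFamily j`, `j ≥ k+1`).  See the module docstring for the hypothesis list; the plateau of the input
family `klAnisoFamily k` is used only over the slice `klSliceCov (k+2)` and the output family (`…NormsStepDoor` §1). -/
theorem klNormsStepWt_of_sliceConsts {E : Type*} [NormedAddCommGroup E] [InnerProductSpace ℂ E]
    {β : ℝ} (hβ : 0 < β) (U μ : ℝ) (K : TrigPolyC4v) (k nw : ℕ)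
    (hZ : klStepPartitionFn L M β U μ K (k + 1) ≠ 0)
    (B : ℕ → ℝ) (hB0 : ∀ m', 0 ≤ B m')
    (hB : ∀ (m' : ℕ) (q : Fin (2 * m')) (w : SpaceTimeIdx L M × SectorLeg (sectorCount k)),
      ∑ Y ∈ univ.filter (fun Y : Fin (2 * m') → SpaceTimeIdx L M × SectorLeg (sectorCount k) => Y q = w),
        klScaleWt L M β nw ((univ.image Y).image (latticeLegPos (2 * (2 * M)))) *
          ‖kernel ℂ (ExteriorAlgebra.map (Matrix.toLin' (sectorAnalysisMatrix L M β (klAnisoFamily L M β μ K klE0 k)))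
            (klEffectiveAction L M β U μ K klE0 (k + 1))) (2 * m') Y‖ ≤ B m')
    (q : SpaceTimeIdx L M × SectorLeg (sectorCount k) → Bool)
    (hC : ∀ X Y, q X = q Y →
      ((sectorSubMatrix L M β (bgmFatMultiplier L M klE0 β (nambuXiCT L μ K) k)).transpose * klSliceCov L M β μ K (k + 2) *
        sectorSubMatrix L M β (bgmFatMultiplier L M klE0 β (nambuXiCT L μ K) k)) X Y = 0)
    (fv gv : SpaceTimeIdx L M × SectorLeg (sectorCount k) → E) {κ : ℝ} (hκ : 0 < κ) (hf : ∀ X, q X = true → ‖fv X‖ ≤ κ)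
    (hg : ∀ Y, q Y = false → ‖gv Y‖ ≤ κ)
    (hGram : ∀ X Y, q X = true → q Y = false →
      contr ℂ ((sectorSubMatrix L M β (bgmFatMultiplier L M klE0 β (nambuXiCT L μ K) k)).transpose * klSliceCov L M β μ K (k + 2) *
        sectorSubMatrix L M β (bgmFatMultiplier L M klE0 β (nambuXiCT L μ K) k)) X Y = ⟪fv X, gv Y⟫_ℂ)
    {α : ℝ} (hα : 0 < α)
    (hrow : ∀ X, ∑ Y, ‖((sectorSubMatrix L M β (bgmFatMultiplier L M klE0 β (nambuXiCT L μ K) k)).transpose *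
      klSliceCov L M β μ K (k + 2) * sectorSubMatrix L M β (bgmFatMultiplier L M klE0 β (nambuXiCT L μ K) k)) X Y‖ *
        klScaleWt L M β nw {latticeLegPos (2 * (2 * M)) X, latticeLegPos (2 * (2 * M)) Y} ≤ α)
    (hcol : ∀ Y, ∑ X, ‖((sectorSubMatrix L M β (bgmFatMultiplier L M klE0 β (nambuXiCT L μ K) k)).transpose *
      klSliceCov L M β μ K (k + 2) * sectorSubMatrix L M β (bgmFatMultiplier L M klE0 β (nambuXiCT L μ K) k)) X Y‖ *
        klScaleWt L M β nw {latticeLegPos (2 * (2 * M)) X, latticeLegPos (2 * (2 * M)) Y} ≤ α)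
    {ρ : ℝ} (hρ : 0 < ρ)
    (hθ : Real.exp 1 * α * normV (SpaceTimeIdx L M × SectorLeg (sectorCount k)) κ ρ
      (fun m' => imagTimeWeight β M ^ (2 * m') * B m') / κ ^ 2 < 1)
    {j : ℕ} (hj : k + 1 ≤ j) {cr cc : ℝ} (hcc0 : 0 ≤ cc)
    (hrow' : ∀ X'', ∑ X', ‖(sectorAnalysisMatrix L M β (klAnisoFamily L M β μ K klE0 j) *
      sectorSubMatrix L M β (bgmFatMultiplier L M klE0 β (nambuXiCT L μ K) k)) X'' X'‖ *
        klScaleWt L M β nw {latticeLegPos (2 * (2 * M)) X'', latticeLegPos (2 * (2 * M)) X'} ≤ cr)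
    (hcol' : ∀ X', ∑ X'', ‖(sectorAnalysisMatrix L M β (klAnisoFamily L M β μ K klE0 j) *
      sectorSubMatrix L M β (bgmFatMultiplier L M klE0 β (nambuXiCT L μ K) k)) X'' X'‖ *
        klScaleWt L M β nw {latticeLegPos (2 * (2 * M)) X'', latticeLegPos (2 * (2 * M)) X'} ≤ cc) :
    klStepPartitionFn L M β U μ K (k + 2) ≠ 0 ∧
      ∀ (m : ℕ) (p : Fin (m + 1)) (w'' : SpaceTimeIdx L M × SectorLeg (sectorCount j)),
        ∑ X'' ∈ univ.filter (fun X'' : Fin (m + 1) → SpaceTimeIdx L M × SectorLeg (sectorCount j) => X'' p = w''),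
            klScaleWt L M β nw ((univ.image X'').image (latticeLegPos (2 * (2 * M)))) *
              ‖kernel ℂ (ExteriorAlgebra.map (Matrix.toLin' (sectorAnalysisMatrix L M β (klAnisoFamily L M β μ K klE0 j)))
                (klEffectiveAction L M β U μ K klE0 (k + 2))) (m + 1) X''‖ ≤
          cr * cc ^ m * (ρ⁻¹ ^ (m + 1) *
            (Real.exp 1 * normV (SpaceTimeIdx L M × SectorLeg (sectorCount k)) κ ρ (fun m' => imagTimeWeight β M ^ (2 * m') * B m')) /
            (1 - Real.exp 1 * α * normV (SpaceTimeIdx L M × SectorLeg (sectorCount k)) κ ρ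
              (fun m' => imagTimeWeight β M ^ (2 * m') * B m') / κ ^ 2)) := by
  have he : (0 : ℝ) < klE0 := by norm_num [klE0]
  -- notation
  set F : Fin (sectorCount k) → FreqMomentum L M → ℂ := klAnisoFamily L M β μ K klE0 k with hF
  set Ft : Fin (sectorCount k) → FreqMomentum L M → ℂ := bgmFatMultiplier L M klE0 β (nambuXiCT L μ K) k with hFt
  set F' : Fin (sectorCount j) → FreqMomentum L M → ℂ := klAnisoFamily L M β μ K klE0 j with hF'
  set G : HubbardGrassmann L M := klEffectiveAction L M β U μ K klE0 (k + 1) with hG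
  set C : Matrix (HubbardFieldIdx L M) (HubbardFieldIdx L M) ℂ := klSliceCov L M β μ K (k + 2) with hCdef
  -- the hypotheses of the weighted plateau step
  have hwt : IsTreeWeight (klScaleWt L M β nw) := isTreeWeight_klScaleWt L M hβ.le nw
  have hFF : ∀ ω p, Ft ω p * F ω p = F ω p := fun ω p => bgmFatMultiplier_mul_bgmMultiplier he β (nambuXiCT L μ K) k ω p
  have hF0 : ∀ p, ∑ ω, F ω p = 0 → ∀ ω, F ω p = 0 := fun p hp ω => klAnisoFamily_eq_zero_of_sum_eq_zero β μ K klE0 k p hp ω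
  have hGe : G ∈ evenPart ℂ (HubbardFieldIdx L M) := mem_evenPart_iff.2 (klw_effectiveAction_mem_evenOdd_zero L M β U μ K (k + 1))
  have hG0 : constPart ℂ G = 0 := constPart_hubbardEffectiveActionCT L M β U μ 0 K hZ
  have hCpl : ∀ X Y, C X Y ≠ 0 → ∑ ω, F ω X.1.1 = 1 ∧ ∑ ω, F ω Y.1.1 = 1 :=
    fun X Y h => sum_klAnisoFamily_eq_one_of_klSliceCov_ne_zero β μ K k X Y h
  have hF'pl : ∀ (ω' : Fin (sectorCount j)) (p : FreqMomentum L M), F' ω' p ≠ 0 → ∑ ω, F ω p = 1 :=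
    fun ω' p h => sum_klAnisoFamily_eq_one_of_klAnisoFamily_ne_zero β μ K hj ω' p h
  -- the weighted plateau step
  obtain ⟨hunit, hbd⟩ := sum_wt_norm_sectorAnalysis_effAction_le_of_plateau hwt (latticeLegPos (2 * (2 * M)))
    (latticeLegPos (2 * (2 * M))) hβ F Ft hFF hF0 F' G hGe hG0 C hCpl hF'pl q hC fv gv hκ hf hg hGram B hB0 hB hα hrow hcol hρ hθ
    hcc0 hrow' hcol'
  -- the step identity and the partition functions
  have hstep : klEffectiveAction L M β U μ K klE0 (k + 2) = effAction ℂ C G := klw_effectiveAction_succ L M β U μ K (k + 1) hZ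
  refine ⟨?_, fun m p w'' => ?_⟩
  · have hZ' : klStepPartitionFn L M β U μ K (k + 2) =
        klStepPartitionFn L M β U μ K (k + 1) * effPartitionFn ℂ C G := by
      have hcov : klHardCov L M β μ K (k + 2) = C + klHardCov L M β μ K (k + 1) := klw_hardCov_succ L M β μ K (k + 1)
      have hu : IsUnit (effPartitionFn ℂ (klHardCov L M β μ K (k + 1)) (hubbardInteractionCT L M β U K)) :=
        isUnit_iff_ne_zero.2 hZ
      show effPartitionFn ℂ (klHardCov L M β μ K (k + 2)) (hubbardInteractionCT L M β U K) =
        effPartitionFn ℂ (klHardCov L M β μ K (k + 1)) (hubbardInteractionCT L M β U K) * effPartitionFn ℂ C G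
      rw [hcov, effPartitionFn_add_of_isUnit _ _ _ hu]
      rfl
    rw [hZ']
    exact mul_ne_zero hZ hunit.ne_zero
  · rw [hstep]
    exact hbd m p w''

/-- **The (E1-W) quantity of `𝒱_{k+2}` in its own family and weight** — the reading `j = nw = k+2` of `klNormsStepWt_of_sliceConsts` in
k3c3-p2's currency: `klWtPinnedSum … (k+2) (m+1) p w″ ≤ ε_x^m·cr·cc^m·ρ^{-(m+1)}·e·normV/(1−θ)` (so `KernelNormsWt N … (k+2)` holds for every
budget `N` with `N (m+1)` above the right side). -/
theorem klWtPinnedSum_le_of_sliceConsts {E : Type*} [NormedAddCommGroup E] [InnerProductSpace ℂ E]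
    {β : ℝ} (hβ : 0 < β) (U μ : ℝ) (K : TrigPolyC4v) (k : ℕ)
    (hZ : klStepPartitionFn L M β U μ K (k + 1) ≠ 0)
    (B : ℕ → ℝ) (hB0 : ∀ m', 0 ≤ B m')
    (hB : ∀ (m' : ℕ) (q : Fin (2 * m')) (w : SpaceTimeIdx L M × SectorLeg (sectorCount k)),
      ∑ Y ∈ univ.filter (fun Y : Fin (2 * m') → SpaceTimeIdx L M × SectorLeg (sectorCount k) => Y q = w),
        klScaleWt L M β (k + 2) ((univ.image Y).image (latticeLegPos (2 * (2 * M)))) *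
          ‖kernel ℂ (ExteriorAlgebra.map (Matrix.toLin' (sectorAnalysisMatrix L M β (klAnisoFamily L M β μ K klE0 k)))
            (klEffectiveAction L M β U μ K klE0 (k + 1))) (2 * m') Y‖ ≤ B m')
    (q : SpaceTimeIdx L M × SectorLeg (sectorCount k) → Bool)
    (hC : ∀ X Y, q X = q Y →
      ((sectorSubMatrix L M β (bgmFatMultiplier L M klE0 β (nambuXiCT L μ K) k)).transpose * klSliceCov L M β μ K (k + 2) *
        sectorSubMatrix L M β (bgmFatMultiplier L M klE0 β (nambuXiCT L μ K) k)) X Y = 0)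
    (fv gv : SpaceTimeIdx L M × SectorLeg (sectorCount k) → E) {κ : ℝ} (hκ : 0 < κ) (hf : ∀ X, q X = true → ‖fv X‖ ≤ κ)
    (hg : ∀ Y, q Y = false → ‖gv Y‖ ≤ κ)
    (hGram : ∀ X Y, q X = true → q Y = false →
      contr ℂ ((sectorSubMatrix L M β (bgmFatMultiplier L M klE0 β (nambuXiCT L μ K) k)).transpose * klSliceCov L M β μ K (k + 2) *
        sectorSubMatrix L M β (bgmFatMultiplier L M klE0 β (nambuXiCT L μ K) k)) X Y = ⟪fv X, gv Y⟫_ℂ)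
    {α : ℝ} (hα : 0 < α)
    (hrow : ∀ X, ∑ Y, ‖((sectorSubMatrix L M β (bgmFatMultiplier L M klE0 β (nambuXiCT L μ K) k)).transpose *
      klSliceCov L M β μ K (k + 2) * sectorSubMatrix L M β (bgmFatMultiplier L M klE0 β (nambuXiCT L μ K) k)) X Y‖ *
        klScaleWt L M β (k + 2) {latticeLegPos (2 * (2 * M)) X, latticeLegPos (2 * (2 * M)) Y} ≤ α)
    (hcol : ∀ Y, ∑ X, ‖((sectorSubMatrix L M β (bgmFatMultiplier L M klE0 β (nambuXiCT L μ K) k)).transpose *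
      klSliceCov L M β μ K (k + 2) * sectorSubMatrix L M β (bgmFatMultiplier L M klE0 β (nambuXiCT L μ K) k)) X Y‖ *
        klScaleWt L M β (k + 2) {latticeLegPos (2 * (2 * M)) X, latticeLegPos (2 * (2 * M)) Y} ≤ α)
    {ρ : ℝ} (hρ : 0 < ρ)
    (hθ : Real.exp 1 * α * normV (SpaceTimeIdx L M × SectorLeg (sectorCount k)) κ ρ
      (fun m' => imagTimeWeight β M ^ (2 * m') * B m') / κ ^ 2 < 1)
    {cr cc : ℝ} (hcc0 : 0 ≤ cc)
    (hrow' : ∀ X'', ∑ X', ‖(sectorAnalysisMatrix L M β (klAnisoFamily L M β μ K klE0 (k + 2)) *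
      sectorSubMatrix L M β (bgmFatMultiplier L M klE0 β (nambuXiCT L μ K) k)) X'' X'‖ *
        klScaleWt L M β (k + 2) {latticeLegPos (2 * (2 * M)) X'', latticeLegPos (2 * (2 * M)) X'} ≤ cr)
    (hcol' : ∀ X', ∑ X'', ‖(sectorAnalysisMatrix L M β (klAnisoFamily L M β μ K klE0 (k + 2)) *
      sectorSubMatrix L M β (bgmFatMultiplier L M klE0 β (nambuXiCT L μ K) k)) X'' X'‖ *
        klScaleWt L M β (k + 2) {latticeLegPos (2 * (2 * M)) X'', latticeLegPos (2 * (2 * M)) X'} ≤ cc)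
    (m : ℕ) (p : Fin (m + 1)) (w'' : SpaceTimeIdx L M × SectorLeg (sectorCount (k + 2))) :
    klWtPinnedSum L M β U μ K (k + 2) (m + 1) p w'' ≤
      imagTimeWeight β M ^ m * (cr * cc ^ m * (ρ⁻¹ ^ (m + 1) *
        (Real.exp 1 * normV (SpaceTimeIdx L M × SectorLeg (sectorCount k)) κ ρ (fun m' => imagTimeWeight β M ^ (2 * m') * B m')) /
        (1 - Real.exp 1 * α * normV (SpaceTimeIdx L M × SectorLeg (sectorCount k)) κ ρ
          (fun m' => imagTimeWeight β M ^ (2 * m') * B m') / κ ^ 2))) := by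
  have h := (klNormsStepWt_of_sliceConsts hβ U μ K k (k + 2) hZ B hB0 hB q hC fv gv hκ hf hg hGram hα hrow hcol hρ hθ (by omega) hcc0
    hrow' hcol').2 m p w''
  rw [klWtPinnedSum_def, Nat.add_sub_cancel]
  exact mul_le_mul_of_nonneg_left h (pow_nonneg (imagTimeWeight_nonneg hβ.le M) m)

end Summit.HubbardSuperconductivity.HubbardSuperconductivity.Theorems.EngineV8

end
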